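import Summits.AtomisticToContinuum.HydrodynamicLimit.Theorems.JParityClosureRateFloorMarkedTransfer
import HarnessLib

/-!
# `JParityClosure.RateFloor`, line `Sketch`: the realised-pair cap (stub S9 `stub_realisedCap`)

Helper file for crux item stmt-AtomisticToContinuum-13080 (route JParityClosure, sub-problem
HydrodynamicLimit), line `Sketch` (`Cruxes/RateFloor/Lines/Sketch.lean`), gen-1 lead.

**Content.** On a hard-sphere trajectory on `𝕋³` (`0 < ε < 1/2`) and a window `(s, t]`, the
REALISED would-be pairs `R` of the window (ordered would-be pairs of `γ s` — free flights within `ε`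
at some time of `(0, t − s]` — none of whose endpoints takes part in a collision strictly before the
pair's first free contact time `t₁ p`) satisfy:

* `realised_mem_contactPairs`: every `p ∈ R` is an ordered contact pair of `γ (s + t₁ p)`, with
  `t₁ p ∈ (0, t − s]` (as in S6d `RateFloorMarkedTransfer.stub_markedTransfer`);
* `fst_injOn_realised`: a particle is the first endpoint of AT MOST ONE realised pair of the window —
  if `(i, j), (i, k) ∈ R` with `t₁ (i,j) < t₁ (i,k)` then `i` participates in a collision (with `j`)
  at `s + t₁ (i,j) ∈ (s, s + t₁ (i,k))`, contradicting the realisation of `(i, k)`; if the two first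
  contact times agree, `(i, j)` and `(i, k)` are contact pairs at the same time, so `j = k` by the
  binary-collision field (`IsHardSphereTrajectory.eq_or_eq_of_mem_contactPairs`);
* hence `#R ≤ N` (`card_realised_le`) and, for a mark bounded by `M ≥ 0` on the window, the realised
  marked sum of the window is at most `N·M` (`stub_realisedCap`, the registered stub, verbatim).

**Why the line needs it.** Summed over the `⌊τ/Δ⌋` windows and multiplied by `ε/(N+1)`, the cap reads
`S_R ≤ ‖χΞ‖∞ · ε_N ⌊τ/Δ_N⌋ ≤ ‖χΞ‖∞ στ/A` for `Δ_N = A(N+1)^{-1/3}`: the realised one-window functional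
SATURATES (first collisions only).  Consequently the cycle-4 stub `OpacityFloorRealised` with `∃ A`
outermost asserted an `r`-independent cap on `σ²∫₀^τ∫χB^Ξ_r` in probability, uniformly over profiles
("no mass focusing at any scale, at any time") — the reason the gen-1 skeleton moves `∃ A` inside and
transfers through the would-be functional instead (see the skeleton's §2').

References: Gallagher–Saint-Raymond–Texier 2013 §4.1 (hard-sphere trajectories); elementary.
-/

noncomputable section

open scoped Classical BigOperators

namespace Summit.AtomisticToContinuum.HydrodynamicLimit.Theorems

open MeasureTheory Set Filter Topology
open Literature.Analysis.FluidPDE Literature.MathematicalPhysics.KineticTheory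

namespace RateFloorRealisedCap

/-- **Realised pairs collide at their first free contact time.**  For `p` realised in the window
`(s, t]` (would-be with first free contact time `t₁ p = inf {u ∈ (0, t−s] | free-flight distance ≤ ε}`,
endpoints undeflected on `(s, s + t₁ p)`): `t₁ p ∈ (0, t − s]` and `p` is an ordered contact pair of
`γ (s + t₁ p)` (`RateFloorMarkedTransfer.first_contact`,
`RateFloorMarkedTransfer.apply_fst_eq_freeFlight_of_not_participates`). [folklore] -/
theorem realised_mem_contactPairs {N : ℕ} {ε : ℝ} {γ : ℝ → Config N (Fin 3) T3}
    (h : IsHardSphereTrajectory (Torus.geometry (Fin 3)) ε N γ) (hε2 : ε < 2⁻¹) {s t : ℝ}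
    {p : Fin N × Fin N} (hne : p.1 ≠ p.2)
    (hex : ∃ u ∈ Set.Ioc 0 (t - s), ‖(Torus.geometry (Fin 3)).sepVec
      (freeFlight (Torus.geometry (Fin 3)) u (γ s) p.1).1 (freeFlight (Torus.geometry (Fin 3)) u (γ s) p.2).1‖ ≤ ε)
    {t₁ : ℝ}
    (ht₁ : t₁ = sInf {u : ℝ | u ∈ Set.Ioc 0 (t - s) ∧ ‖(Torus.geometry (Fin 3)).sepVec
      (freeFlight (Torus.geometry (Fin 3)) u (γ s) p.1).1 (freeFlight (Torus.geometry (Fin 3)) u (γ s) p.2).1‖ ≤ ε})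
    (hp1 : ∀ u ∈ Set.Ioo s (s + t₁), ¬ Participates (Torus.geometry (Fin 3)) ε (γ u) p.1)
    (hp2 : ∀ u ∈ Set.Ioo s (s + t₁), ¬ Participates (Torus.geometry (Fin 3)) ε (γ u) p.2) :
    t₁ ∈ Set.Ioc 0 (t - s) ∧ p ∈ contactPairs (Torus.geometry (Fin 3)) ε (γ (s + t₁)) := by
  have hG : (Torus.geometry (Fin 3)).IsHardSphereRegular ε := Torus.isHardSphereRegular_geometry hε2
  obtain ⟨δ, hδ, hsep⟩ := RateFloorWindowPreemption.exists_sep_window h hε2 s hne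
  have hcont : Continuous fun u : ℝ => ‖(Torus.geometry (Fin 3)).sepVec
      (freeFlight (Torus.geometry (Fin 3)) u (γ s) p.1).1
      (freeFlight (Torus.geometry (Fin 3)) u (γ s) p.2).1‖ := by
    simpa only [Function.comp_def] using
      (hG.continuous_norm_sepVec_config p.1 p.2).comp (hG.continuous_freeFlight (γ s))
  have hτ := RateFloorMarkedTransfer.first_contact hcont hδ hsep hex ht₁
  have hpos1 := RateFloorMarkedTransfer.apply_fst_eq_freeFlight_of_not_participates h hτ.1.1 hp1
  have hpos2 := RateFloorMarkedTransfer.apply_fst_eq_freeFlight_of_not_participates h hτ.1.1 hp2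
  refine ⟨hτ.1, (mem_contactPairs_iff_of_mem (h.mem _)).2 ⟨hne, ?_⟩⟩
  rw [hpos1, hpos2]
  exact hτ.2

/-- **A particle is the first endpoint of at most one realised pair of a window** (`Prod.fst` is
injective on the realised pairs): two realised pairs `(i, j)`, `(i, k)` with different first contact
times contradict the realisation of the later one (`i` takes part in the earlier collision), and with
equal first contact times they are contact pairs at the same instant, so `j = k` by the
binary-collision field. [folklore] -/
theorem fst_injOn_realised {N : ℕ} {ε : ℝ} {γ : ℝ → Config N (Fin 3) T3}
    (h : IsHardSphereTrajectory (Torus.geometry (Fin 3)) ε N γ) (hε2 : ε < 2⁻¹) {s t : ℝ}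
    {t₁ : Fin N × Fin N → ℝ}
    (ht₁ : ∀ p, t₁ p = sInf {u : ℝ | u ∈ Set.Ioc 0 (t - s) ∧ ‖(Torus.geometry (Fin 3)).sepVec
        (freeFlight (Torus.geometry (Fin 3)) u (γ s) p.1).1 (freeFlight (Torus.geometry (Fin 3)) u (γ s) p.2).1‖ ≤ ε})
    {R : Finset (Fin N × Fin N)}
    (hR : R = Finset.univ.filter fun p => p.1 ≠ p.2 ∧
      (∃ u ∈ Set.Ioc 0 (t - s), ‖(Torus.geometry (Fin 3)).sepVec
        (freeFlight (Torus.geometry (Fin 3)) u (γ s) p.1).1 (freeFlight (Torus.geometry (Fin 3)) u (γ s) p.2).1‖ ≤ ε) ∧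
      (∀ u ∈ Set.Ioo s (s + t₁ p), ¬ Participates (Torus.geometry (Fin 3)) ε (γ u) p.1) ∧
      (∀ u ∈ Set.Ioo s (s + t₁ p), ¬ Participates (Torus.geometry (Fin 3)) ε (γ u) p.2)) :
    Set.InjOn Prod.fst (R : Set (Fin N × Fin N)) := by
  intro p hp q hq hpq
  rw [Finset.mem_coe, hR] at hp hq
  obtain ⟨-, hpne, hpex, hp1, hp2⟩ := Finset.mem_filter.1 hp
  obtain ⟨-, hqne, hqex, hq1, hq2⟩ := Finset.mem_filter.1 hq
  obtain ⟨hpτ, hpc⟩ := realised_mem_contactPairs h hε2 hpne hpex (ht₁ p) hp1 hp2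
  obtain ⟨hqτ, hqc⟩ := realised_mem_contactPairs h hε2 hqne hqex (ht₁ q) hq1 hq2
  -- `i := p.1 = q.1` participates at both collision instants
  have hPp : Participates (Torus.geometry (Fin 3)) ε (γ (s + t₁ p)) p.1 := ⟨p.2, Or.inl hpc⟩
  have hPq : Participates (Torus.geometry (Fin 3)) ε (γ (s + t₁ q)) q.1 := ⟨q.2, Or.inl hqc⟩
  rcases lt_trichotomy (t₁ p) (t₁ q) with hlt | heq | hgt
  · -- the earlier collision of `i` pre-empts `q`
    exact absurd (hpq ▸ hPp) (hq1 (s + t₁ p) ⟨by linarith [hpτ.1], by linarith⟩)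
  · -- same instant: binary collisions force the partners to agree
    have hqc' : (p.1, q.2) ∈ contactPairs (Torus.geometry (Fin 3)) ε (γ (s + t₁ p)) := by
      rw [heq, hpq]; exact hqc
    rcases h.eq_or_eq_of_mem_contactPairs hpc hqc' with he | he
    · exact Prod.ext hpq (Prod.mk.inj he).2.symm
    · exact absurd (Prod.mk.inj he).1 hpne
  · exact absurd (hpq.symm ▸ hPq) (hp1 (s + t₁ q) ⟨by linarith [hqτ.1], by linarith⟩)

/-- **At most `N` realised pairs per window.** [folklore] -/
theorem card_realised_le {N : ℕ} {ε : ℝ} {γ : ℝ → Config N (Fin 3) T3}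
    (h : IsHardSphereTrajectory (Torus.geometry (Fin 3)) ε N γ) (hε2 : ε < 2⁻¹) {s t : ℝ}
    {t₁ : Fin N × Fin N → ℝ}
    (ht₁ : ∀ p, t₁ p = sInf {u : ℝ | u ∈ Set.Ioc 0 (t - s) ∧ ‖(Torus.geometry (Fin 3)).sepVec
        (freeFlight (Torus.geometry (Fin 3)) u (γ s) p.1).1 (freeFlight (Torus.geometry (Fin 3)) u (γ s) p.2).1‖ ≤ ε})
    {R : Finset (Fin N × Fin N)}
    (hR : R = Finset.univ.filter fun p => p.1 ≠ p.2 ∧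
      (∃ u ∈ Set.Ioc 0 (t - s), ‖(Torus.geometry (Fin 3)).sepVec
        (freeFlight (Torus.geometry (Fin 3)) u (γ s) p.1).1 (freeFlight (Torus.geometry (Fin 3)) u (γ s) p.2).1‖ ≤ ε) ∧
      (∀ u ∈ Set.Ioo s (s + t₁ p), ¬ Participates (Torus.geometry (Fin 3)) ε (γ u) p.1) ∧
      (∀ u ∈ Set.Ioo s (s + t₁ p), ¬ Participates (Torus.geometry (Fin 3)) ε (γ u) p.2)) :
    R.card ≤ N := by
  have hinj := fst_injOn_realised h hε2 ht₁ hR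
  calc R.card ≤ (Finset.univ : Finset (Fin N)).card :=
        Finset.card_le_card_of_injOn Prod.fst (fun p _ => Finset.mem_coe.2 (Finset.mem_univ _)) hinj
    _ = N := by rw [Finset.card_univ, Fintype.card_fin]

/-- **S9 · realised-pair cap** (registered stub `stub_realisedCap` of the line `Sketch` for
`JParityClosure.RateFloor`, stmt-AtomisticToContinuum-13080, verbatim; hypotheses-by-equation style of
S6d/S8).  On a hard-sphere trajectory on `𝕋³` with `0 < ε < 1/2` and a window `(s, t]`, for a mark `F`
bounded by `M ≥ 0` on the window, the realised pairs `R` number at most `N` and their marked sum (marks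
read at the predicted datum, as in the line's `realisedSum`) is at most `N · M`: each particle is the
first endpoint of at most one realised pair (`fst_injOn_realised`). [folklore] -/
theorem stub_realisedCap :
    ∀ (N : ℕ) (ε : ℝ) (γ : ℝ → Config N (Fin 3) T3),
    IsHardSphereTrajectory (Torus.geometry (Fin 3)) ε N γ → 0 < ε → ε < 2⁻¹ →
    ∀ (s t : ℝ), s < t →
      ∀ (F : ℝ → T3 → T3 → V3 → V3 → ℝ) (M : ℝ), 0 ≤ M →
      (∀ u ∈ Set.Ioc s t, ∀ x y v w, F u x y v w ≤ M) →
      ∀ (t₁ : Fin N × Fin N → ℝ),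
      (∀ p, t₁ p = sInf {u : ℝ | u ∈ Set.Ioc 0 (t - s) ∧ ‖(Torus.geometry (Fin 3)).sepVec
          (freeFlight (Torus.geometry (Fin 3)) u (γ s) p.1).1 (freeFlight (Torus.geometry (Fin 3)) u (γ s) p.2).1‖ ≤ ε}) →
      ∀ (R : Finset (Fin N × Fin N)),
      (R = Finset.univ.filter fun p => p.1 ≠ p.2 ∧
        (∃ u ∈ Set.Ioc 0 (t - s), ‖(Torus.geometry (Fin 3)).sepVec
          (freeFlight (Torus.geometry (Fin 3)) u (γ s) p.1).1 (freeFlight (Torus.geometry (Fin 3)) u (γ s) p.2).1‖ ≤ ε) ∧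
        (∀ u ∈ Set.Ioo s (s + t₁ p), ¬ Participates (Torus.geometry (Fin 3)) ε (γ u) p.1) ∧
        (∀ u ∈ Set.Ioo s (s + t₁ p), ¬ Participates (Torus.geometry (Fin 3)) ε (γ u) p.2)) →
      R.card ≤ N ∧
      ∑ p ∈ R, F (s + t₁ p) (freeFlight (Torus.geometry (Fin 3)) (t₁ p) (γ s) p.1).1
          (freeFlight (Torus.geometry (Fin 3)) (t₁ p) (γ s) p.2).1 ((γ s p.1).2) ((γ s p.2).2) ≤ N * M := by
  intro N ε γ h _hε hε2 s t _hst F M hM hFM t₁ ht₁ R hR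
  have hcard := card_realised_le h hε2 ht₁ hR
  refine ⟨hcard, ?_⟩
  have hterm : ∀ p ∈ R, F (s + t₁ p) (freeFlight (Torus.geometry (Fin 3)) (t₁ p) (γ s) p.1).1
      (freeFlight (Torus.geometry (Fin 3)) (t₁ p) (γ s) p.2).1 ((γ s p.1).2) ((γ s p.2).2) ≤ M := by
    intro p hp
    have hp' := hp
    rw [hR] at hp'
    obtain ⟨-, hpne, hpex, hp1, hp2⟩ := Finset.mem_filter.1 hp'
    obtain ⟨hpτ, -⟩ := realised_mem_contactPairs h hε2 hpne hpex (ht₁ p) hp1 hp2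
    exact hFM (s + t₁ p) ⟨by linarith [hpτ.1], by linarith [hpτ.2]⟩ _ _ _ _
  calc ∑ p ∈ R, F (s + t₁ p) (freeFlight (Torus.geometry (Fin 3)) (t₁ p) (γ s) p.1).1
          (freeFlight (Torus.geometry (Fin 3)) (t₁ p) (γ s) p.2).1 ((γ s p.1).2) ((γ s p.2).2)
      ≤ ∑ _p ∈ R, M := Finset.sum_le_sum hterm
    _ = R.card * M := by rw [Finset.sum_const, nsmul_eq_mul]
    _ ≤ N * M := by exact_mod_cast mul_le_mul_of_nonneg_right (Nat.cast_le.2 hcard) hM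

end RateFloorRealisedCap

end Summit.AtomisticToContinuum.HydrodynamicLimit.Theorems

end
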